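import Summits.FinalStateConjecture.FinalStateConjecture.Theses.PhotonSphereChannels
import Summits.FinalStateConjecture.FinalStateConjecture.Theorems.PhotonSphereChannelsTameCensorshipReduction
import Summits.FinalStateConjecture.FinalStateConjecture.Theorems.TameCensorship.Negative.GenericityAndFails
import Literature.Geometry.Lorentzian.ModelData

/-!
# Line `necks-are-one-way-valves` — skeleton for the crux `PhotonSphereChannels.TameCensorship`
(crux item stmt-FinalStateConjecture-10047, K3; planner crux-plan seat, round 1)

THE LINE ("no-way valve" = bifurcate-throat burial + two-sided sector split). Clause (i) of the
crux (no extremal late chart, `IsLateChart … Set.univ`) and clause (ii) (uniform-scale tameness of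
`outer`, built from ALL future-complete rays) read the HIDDEN sectors of an MGHD, and clause (i)
is orientation-blind, hence also reads the PAST (Disproof.lean §6; TRIAGE r1-2 F1′). Split every
chart / ray into SHIELDED (inside the two-sided Cauchy development `D(ι K)` of a compact piece of
data) and ESCAPING (not). Through every admissible datum `d` run ONE jointly smooth admissible
curve `c ↦ F c` (support-separated composition of two moves, so that "genericity is not closed
under ∧" — `Theorems.TameCensorship.Negative.isChristodoulouGeneric_and_fails` — is never
invoked): (1) cure `d` on a compact set so that its own shielded sector is tame
(`stub_hiddenCure`, the open kernel), (2) bury the cured core BEHIND THE EINSTEIN–ROSEN THROAT of an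
exact time-symmetric Schwarzschild end (`stub_beltedBurial`): `F c` is isometric to
`({ρ > ρ₂}, (1 + M/2ρ)⁴ δ, 0)`, `ρ₂ < M/2`, outside a compact "bag". The throat is then a valve in
NEITHER direction for the bag: `W = D(ι(exact piece))` is exact Kruskal (region I, both horizons,
the bifurcation sphere, strips of regions II/IV) in BOTH time directions, and `J±(ι bag)` touch
only a bounded part of the exterior sheet (`stub_neckValve`, the sealing lemma). Hence complete
`𝓘⁺` and the ESCAPING sectors of (i) — charts of either orientation — and of (ii) are exact
Kruskal bookkeeping (`stub_escapingKruskal`, via `PolarRigiditySchwarzschild` of the sibling line),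
the past residue of every region-II burial disappears, and what is left is exactly the two-sided
shielded sector of the members — belted throat completions of the cured core, whose BELT
(time-symmetric, nowhere Ricci-flat) is two-sided mortal by Hawking's bound, so that the open
content is the boxed core's (`stub_hiddenCure`).
MGHD existence (`stub_mghdExists` = shared item stmt-FinalStateConjecture-9937, Choquet-Bruhat–
Geroch) supplies the anti-vacuity conjunct (Disproof §3: the crux has existential content).
`TameCensorship_of` composes the five stubs into the crux BY NAME with a real proof (local families
suffice, `isChristodoulouGeneric_one_of_local`; sector recombination by case split and
`min r₀ / max Λ`).

Checked against the landed Negative lemmas (imported): no stub is an instance of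
`isChristodoulouGeneric_and_fails` (one curve is built, no ∧-closure), `exists_isMaximal_of_
tameCensorship` is honoured by `stub_mghdExists`, `not_tameCensorship_iff`/§7 are untouched.
-/

set_option linter.dupNamespace false

open Literature.Geometry.Lorentzian
open scoped Manifold ContDiff Topology
open Filter Set

noncomputable section

namespace Summit.FinalStateConjecture.FinalStateConjecture.Cruxes.TameCensorship.NecksAreOneWayValves

/-! ## Sector selectors (two-sided shielding) -/

section Defs

variable {X : Type} [TopologicalSpace X] [ChartedSpace E3 X] [IsManifold (𝓡 3) ∞ X]
  [ConnectedSpace X] {D : InitialDataSet (𝓡 3) X}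

/-- `S` is SHIELDED (two-sided): it lies in the Cauchy development `D(ι K) = D⁺(ι K) ∪ D⁻(ι K)`
of the image of a COMPACT subset `K` of the data manifold. -/
def IsShielded (𝒟 : CauchyDevelopment D) (S : Set 𝒟.carrier) : Prop :=
  ∃ K : Set X, IsCompact K ∧
    S ⊆ 𝒟.metric.cauchyDevelopment 𝒟.timeOrientation (𝒟.embed '' K)

/-- Ray selector: the future branch `γ(dom ∩ [0,∞))` of a ray from the data is SHIELDED iff it
lies in `D⁺(ι K)` for a compact `K`. -/
def IsShieldedRay (𝒟 : CauchyDevelopment D) (γ : ℝ → 𝒟.carrier) (dom : Set ℝ) : Prop :=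
  ∃ K : Set X, IsCompact K ∧
    γ '' (dom ∩ Set.Ici 0) ⊆ 𝒟.metric.futureCauchyDevelopment 𝒟.timeOrientation (𝒟.embed '' K)

/-- The LATE POLAR NEAR ZONE `{t* > τ₁, r ≤ 3M, |z| ≥ r/2}` of the boosted Kerr background
(Kerr–Schild `z = r cos θ`): on it the complex quadratic Weyl invariant of EXTREMAL Kerr has
argument in `(56°, 270°]`, off the positive axis where Schwarzschild's lies (sibling sketch
`ShieldSplit.latePolarNearZone`, verbatim). -/
def latePolarNearZone (Λ : lorentzGroup) (c : E4) (M a : ℝ) (τ₁ : ℝ) :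
    Set (boostedKerrBackground Λ c M a).domain :=
  {x | x ∈ (boostedKerrBackground Λ c M a).lateRegion τ₁ ∧
    (boostedKerrBackground Λ c M a).radius x.1 ≤ 3 * M ∧
    (boostedKerrBackground Λ c M a).radius x.1 / 2 ≤ |poincareInv Λ c x.1 3|}

/-- Chart selector (orientation-blind, two-sided): a late chart modelled on boosted Kerr is
SHIELDED iff the image of some late polar near zone is shielded. -/
def IsShieldedChart (𝒟 : CauchyDevelopment D) (Λ : lorentzGroup) (c : E4) (M a : ℝ)
    (Ψ : (boostedKerrBackground Λ c M a).domain → 𝒟.carrier) : Prop :=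
  ∃ τ₁ : ℝ, IsShielded 𝒟 (Ψ '' latePolarNearZone Λ c M a τ₁)

/-- Clause (i) of the crux restricted to the charts selected by `sel` (with `sel := ⊤` it is
verbatim clause (i)). -/
def NoExtremalRemnant (𝒟 : VacuumCauchyDevelopment D)
    (sel : ∀ (Λ : lorentzGroup) (c : E4) (M a : ℝ),
      ((boostedKerrBackground Λ c M a).domain → 𝒟.carrier) → Prop) : Prop :=
  ∀ (Λ : lorentzGroup) (c : E4) (M a : ℝ), Kerr.IsExtremal M a →
    ¬ ∃ (τ₀ : ℝ) (Ψ : (boostedKerrBackground Λ c M a).domain → 𝒟.carrier),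
      𝒟.toSpacetime.IsLateChart (boostedKerrBackground Λ c M a) Set.univ τ₀ Ψ ∧
      sel Λ c M a Ψ ∧
      ∀ R : ℝ, Tendsto (fun τ ↦ 𝒟.toSpacetime.truncDeviationCk
        (boostedKerrBackground Λ c M a) Ψ 2 R τ) atTop (𝓝 0)

/-- Clause (ii) of the crux restricted to the rays selected by `sel`, in SCALE-DOWNWARD-CLOSED form:
there is a scale `r₁ > 0` such that at EVERY scale `0 < r₀ ≤ r₁` a uniform `C³` bound `Λ(r₀)`
holds on Minkowski-ball charts of radius `r₀` centred at the points of `outer(sel)`. (Implies the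
crux's form of (ii) for the selected rays — take `r₀ = r₁` — and is what bounded geometry gives
anyway; the form makes the recombination of two selectors pure logic: `min r₀`, `max Λ`.) -/
def TameOuterAtScale (𝒟 : VacuumCauchyDevelopment D)
    (sel : (ℝ → 𝒟.carrier) → Set ℝ → Prop) : Prop :=
  ∀ [𝒟.metric.HasLeviCivita],
    ∃ r₁ : ℝ, 0 < r₁ ∧ ∀ r₀ : ℝ, 0 < r₀ → r₀ ≤ r₁ → ∃ Λ : NNReal,
      ∀ q ∈ (𝒟.metric.causalFuture 𝒟.timeOrientation (Set.range 𝒟.embed) ∩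
        {q | ∃ (p : X) (γ : ℝ → 𝒟.carrier) (dom : Set ℝ),
          𝒟.metric.IsNormalisedNullRayFrom 𝒟.timeOrientation 𝒟.embed 𝒟.normal p γ dom ∧
          ¬ BddAbove dom ∧ sel γ dom ∧
          q ∈ 𝒟.metric.chronologicalPast 𝒟.timeOrientation (γ '' (dom ∩ Set.Ici 0))}),
      let U : TopologicalSpace.Opens E4 := ⟨Metric.ball (0 : E4) r₀, Metric.isOpen_ball⟩;
      ∃ Ψ : U → 𝒟.carrier,
        𝒟.toSpacetime.IsLateChart (Minkowski.backgroundOn U) Set.univ (-r₀) Ψ ∧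
        (∃ x : U, (x : E4) = 0 ∧ Ψ x = q) ∧
        supCkENorm (U : Set E4) 3 (𝒟.toSpacetime.deviationExtend (Minkowski.backgroundOn U) Ψ)
          ≤ (Λ : ENNReal) ∧
        supCkENorm (U : Set E4) 0 (𝒟.toSpacetime.deviationExtend (Minkowski.backgroundOn U) Ψ)
          ≤ 1 / 2

/-- ESCAPING sector of clauses (i)–(ii): charts whose late polar near zones are never shielded,
rays whose future branch is not shielded. -/
def QEsc (𝒟 : VacuumCauchyDevelopment D) : Prop :=
  NoExtremalRemnant 𝒟 (fun Λ c M a Ψ ↦ ¬ IsShieldedChart 𝒟.toCauchyDevelopment Λ c M a Ψ) ∧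
    TameOuterAtScale 𝒟 (fun γ dom ↦ ¬ IsShieldedRay 𝒟.toCauchyDevelopment γ dom)

/-- SHIELDED (hidden) sector of clauses (i)–(ii): the two-sided hidden-sector tameness. -/
def QSh (𝒟 : VacuumCauchyDevelopment D) : Prop :=
  NoExtremalRemnant 𝒟 (fun Λ c M a Ψ ↦ IsShieldedChart 𝒟.toCauchyDevelopment Λ c M a Ψ) ∧
    TameOuterAtScale 𝒟 (fun γ dom ↦ IsShieldedRay 𝒟.toCauchyDevelopment γ dom)

/-- `φ` is a THROAT CHART of the datum `D` with mass `M > 0` and inner isotropic radius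
`ρ₂ ∈ (0, M/2)`: a smooth open embedding of `{y ∈ E3 | ρ₂ < ‖y‖}` onto the complement of a
COMPACT subset of `X` (the "bag") along which `D` is EXACTLY the time-symmetric Schwarzschild
data `((1 + M/(2‖y‖))⁴ δ, 0)` — sheet I (`‖y‖ > M/2`), the minimal throat `‖y‖ = M/2` and a collar
`ρ₂ < ‖y‖ < M/2` of sheet II (`Schwarzschild.conformalInner`, `ModelData.lean`). -/
def IsThroatChart (D : InitialDataSet (𝓡 3) X) (M ρ₂ : ℝ) (φ : exteriorRegion ρ₂ → X) : Prop :=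
  0 < ρ₂ ∧ ρ₂ < M / 2 ∧
    ContMDiff 𝓘(ℝ, E3) (𝓡 3) ∞ φ ∧ Topology.IsOpenEmbedding φ ∧ IsCompact (Set.range φ)ᶜ ∧
    ∀ y : exteriorRegion ρ₂,
      pullbackBilin (I := 𝓡 3) (I' := 𝓘(ℝ, E3)) φ D.h.inner y =
          Schwarzschild.conformalInner M (exteriorRegion ρ₂) y ∧
        pullbackBilin (I := 𝓡 3) (I' := 𝓘(ℝ, E3)) φ D.k y = 0

/-- `D` is THROAT-SHIELDED ("swallowed into the second sheet"): it admits a throat chart. -/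
def IsThroatShielded (D : InitialDataSet (𝓡 3) X) : Prop :=
  ∃ (M ρ₂ : ℝ) (φ : exteriorRegion ρ₂ → X), IsThroatChart D M ρ₂ φ

end Defs

/-! ## The five stub statements -/

/-- MGHD EXISTENCE on admissible data (shared item stmt-FinalStateConjecture-9937, verbatim the body of
`Theses.SwallowTheDatum.MGHDExists`; Choquet-Bruhat–Geroch 1969 Thm 3 / Sbierski 2016 Thm 2.6,
the Literature named fact `choquetBruhat_geroch_exists_mghd_cauchy`). The crux has this
existential content (Disproof §3, `exists_isMaximal_of_tameCensorship`). -/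
def MGHDExistsOnAdmissible : Prop :=
  ∀ (X : Type) [TopologicalSpace X] [ChartedSpace E3 X] [IsManifold (𝓡 3) ∞ X] [T2Space X]
    [SecondCountableTopology X] [ConnectedSpace X],
    ∀ D ∈ admissibleVacuumData X, ∃ 𝒟 : VacuumCauchyDevelopment D, 𝒟.IsMaximal

/-- Two data sets AGREE at the point `x` (same metric and same second fundamental form there). -/
def AgreeAt {X : Type} [TopologicalSpace X] [ChartedSpace E3 X] [IsManifold (𝓡 3) ∞ X]
    (D E : InitialDataSet (𝓡 3) X) (x : X) : Prop :=
  D.h.inner x = E.h.inner x ∧ D.k x = E.k x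

/-- `G` is a COMPACTLY SUPPORTED CURE of the datum `d` with parameter range `|s| < ε` and support
`K`: a jointly smooth one-parameter deformation with `G 0 = d`, admissible for small parameters,
equal to `d` off the compact set `K` (no injectivity: `G` may be constant). -/
def IsCompactCure {X : Type} [TopologicalSpace X] [ChartedSpace E3 X] [IsManifold (𝓡 3) ∞ X]
    [ConnectedSpace X] (d : InitialDataSet (𝓡 3) X) (ε : ℝ) (K : Set X)
    (G : EuclideanSpace ℝ (Fin 1) → InitialDataSet (𝓡 3) X) : Prop :=
  0 < ε ∧ IsCompact K ∧ InitialDataSet.IsSmoothDataFamily 1 G ∧ G 0 = d ∧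
    (∀ s : EuclideanSpace ℝ (Fin 1), |s 0| < ε → G s ∈ admissibleVacuumData X) ∧
    ∀ (s : EuclideanSpace ℝ (Fin 1)) (x : X), x ∉ K → AgreeAt (G s) d x

/-- `D'` is a BELTED THROAT COMPLETION of the core `E` beyond the compact set `K'`: `D'` agrees
with `E` on an open neighbourhood `U` of `K'`, is throat-shielded by some throat chart `φ`, and on
the BELT `X ∖ (U ∪ range φ)` (a compact part of the bag) it is TIME-SYMMETRIC and NOWHERE
RICCI-FLAT (`k = 0`, `Ric(h) ≠ 0`) — the certifiable design property under which the geodesic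
slices `t = ±t₀` off the belt are uniformly contracting to the future / to the past
(`∂ₜ tr k = -|k|²`, `k̇ = -Ric(h)` at `k = 0`), so that Hawking's length bound makes the belt's
own two-sided development mortal and the hidden sector of `D'` is that of the boxed core. -/
def IsBeltedCompletion {X : Type} [TopologicalSpace X] [ChartedSpace E3 X] [IsManifold (𝓡 3) ∞ X]
    (D' E : InitialDataSet (𝓡 3) X) (K' : Set X) : Prop :=
  ∃ U : Set X, IsOpen U ∧ K' ⊆ U ∧ (∀ x ∈ U, AgreeAt D' E x) ∧
    ∃ (M ρ₂ : ℝ) (φ : exteriorRegion ρ₂ → X), IsThroatChart D' M ρ₂ φ ∧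
      (∀ x : X, x ∉ U → x ∉ Set.range φ → D'.k x = 0) ∧
      ∀ [D'.metric.HasLeviCivita], ∀ x : X, x ∉ U → x ∉ Set.range φ → D'.metric.ricci x ≠ 0

/-- HIDDEN-SECTOR GENERICITY IN THE BOX (the open kernel of the crux, two-sided, in the CURABLE
form the crux itself asserts and locality makes necessary, with everything the line can certify
about the box built in): through every admissible datum `d` passes a compactly supported cure `G`
such that for every small `s ≠ 0`, EVERY admissible belted throat completion `D'` of the cured
core `G s` (beyond any compact `K' ⊇ K`) is HIDDEN-TAME: in every MGHD of `D'`, no late chart of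
either time orientation with SHIELDED late polar near zones converges in `C²` to extremal Kerr, and
the shielded outer region (pasts of future branches of shielded complete rays) has bounded `C³`
geometry at a uniform scale (`QSh`). The belt is two-sided mortal by Hawking's bound, the cured
core's own shielded kernels are inherited by domain-of-dependence locality; what remains — that
a big crunch engulfs an isolated vacuum system up to its pinched-off baby universes ("final state
in a box") — is the honest open content. On `X ≅ ℝ³` it is closed-universe recollapse in AF
clothing; on `Y # ℝ³` with eternal fillings it is an interior final-state-type genericity. -/
def HiddenSectorGenericity : Prop :=
  ∀ (X : Type) [TopologicalSpace X] [ChartedSpace E3 X] [IsManifold (𝓡 3) ∞ X] [T2Space X]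
    [SecondCountableTopology X] [ConnectedSpace X],
    ∀ d ∈ admissibleVacuumData X,
      ∃ (ε : ℝ) (K : Set X) (G : EuclideanSpace ℝ (Fin 1) → InitialDataSet (𝓡 3) X),
        IsCompactCure d ε K G ∧
        ∀ s : EuclideanSpace ℝ (Fin 1), s ≠ 0 → |s 0| < ε →
          ∀ K' : Set X, IsCompact K' → K ⊆ K' →
            ∀ D' ∈ admissibleVacuumData X, IsBeltedCompletion D' (G s) K' →
              ∀ 𝒟 : VacuumCauchyDevelopment D', 𝒟.IsMaximal → QSh 𝒟

/-- BELTED THROAT BURIAL (the engine; pure gluing / design, no dynamics): given ANY compactly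
supported cure `G` of an admissible `d`, there is a jointly smooth family `F` through `d`,
injective and admissible for small parameters, whose members `F c`, `c ≠ 0`, are admissible
belted throat completions of cured cores `G (s c)` with `0 < |s c| < ε` (Einstein–Rosen-throat
burial: the cured core kept exactly on a neighbourhood of a compact `K' ⊇ K`, glued by localized
gluing into a nearly flat socket of a KID-free time-symmetric scalar-flat nowhere-Ricci-flat bag
whose end is exact Schwarzschild sheet I ∪ throat ∪ collar — a Green's-function bag of a bumpy
Yamabe-positive `S³`, exactified across the throat by Corvino / Chruściel–Delay gluing with the
one-parameter mass compensation of the static KID; receding socket radius `R(c) = exp(1/c²)`,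
joint `C^∞` at `c = 0` by eventual constancy, injectivity by strictly monotone mass `M(c)`). -/
def BeltedThroatBurial : Prop :=
  ∀ (X : Type) [TopologicalSpace X] [ChartedSpace E3 X] [IsManifold (𝓡 3) ∞ X] [T2Space X]
    [SecondCountableTopology X] [ConnectedSpace X],
    ∀ d ∈ admissibleVacuumData X,
      ∀ (ε : ℝ) (K : Set X) (G : EuclideanSpace ℝ (Fin 1) → InitialDataSet (𝓡 3) X),
        IsCompactCure d ε K G →
        ∃ (ε' : ℝ) (F : EuclideanSpace ℝ (Fin 1) → InitialDataSet (𝓡 3) X), 0 < ε' ∧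
          InitialDataSet.IsSmoothDataFamily 1 F ∧ F 0 = d ∧
          (∀ c c' : EuclideanSpace ℝ (Fin 1), |c 0| < ε' → |c' 0| < ε' → F c = F c' → c = c') ∧
          (∀ c : EuclideanSpace ℝ (Fin 1), |c 0| < ε' → F c ∈ admissibleVacuumData X) ∧
          ∀ c : EuclideanSpace ℝ (Fin 1), c ≠ 0 → |c 0| < ε' →
            ∃ s : EuclideanSpace ℝ (Fin 1), s ≠ 0 ∧ |s 0| < ε ∧
              ∃ K' : Set X, IsCompact K' ∧ K ⊆ K' ∧ IsBeltedCompletion (F c) (G s) K'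

/-- THE THROAT IS A NO-WAY VALVE (two-sided sealing lemma — the card's lever as a theorem). In every
MGHD of an admissible datum with a throat chart `φ`, the causal future of the bag `ι(X ∖ range φ)`
within `J⁺(ιX)` lies in `D⁺(ι K₁)`, and its causal past within `J⁻(ιX)` lies in `D⁻(ι K₁)`,
for ONE compact `K₁ ⊆ X`: whatever lies beyond the throat can causally touch only a bounded part
of the exterior sheet, forwards AND backwards in time (Kruskal: the bag's slice is `{U ≥ s}`,
`s > 0`; `J⁺ ⊆ {U ≥ s}` meets the singularity at `V = 1/s`; dually `J⁻ ⊆ {V ≤ -s}`; the exact piece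
`D(ι range φ) ⊇ {U < s, V > -s}` by sub-data locality). -/
def NeckValve : Prop :=
  ∀ (X : Type) [TopologicalSpace X] [ChartedSpace E3 X] [IsManifold (𝓡 3) ∞ X] [T2Space X]
    [SecondCountableTopology X] [ConnectedSpace X],
    ∀ D ∈ admissibleVacuumData X, ∀ (M ρ₂ : ℝ) (φ : exteriorRegion ρ₂ → X),
      IsThroatChart D M ρ₂ φ →
      ∀ 𝒟 : VacuumCauchyDevelopment D, 𝒟.IsMaximal →
        ∃ K₁ : Set X, IsCompact K₁ ∧
          𝒟.metric.causalFuture 𝒟.timeOrientation (𝒟.embed '' (Set.range φ)ᶜ) ∩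
              𝒟.metric.causalFuture 𝒟.timeOrientation (Set.range 𝒟.embed) ⊆
            𝒟.metric.futureCauchyDevelopment 𝒟.timeOrientation (𝒟.embed '' K₁) ∧
          𝒟.metric.causalPast 𝒟.timeOrientation (𝒟.embed '' (Set.range φ)ᶜ) ∩
              𝒟.metric.causalPast 𝒟.timeOrientation (Set.range 𝒟.embed) ⊆
            𝒟.metric.pastCauchyDevelopment 𝒟.timeOrientation (𝒟.embed '' K₁)

/-- ESCAPING SECTORS ARE KRUSKAL BOOKKEEPING: every MGHD of a throat-shielded admissible datum
has complete `𝓘⁺` (sojourn form) and satisfies the ESCAPING halves of clauses (i) (charts of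
either orientation) and (ii) — everything escaping lives in the exact Kruskal piece
`D(ι(exact sheet))` by the valve, where `PolarRigiditySchwarzschild` (sibling line
shield-split-recollapse) excludes `C²`-extremal near zones and Kerr–Schild coordinates bound the
geometry at every scale below `M`. -/
def EscapingSectorsKruskal : Prop :=
  ∀ (X : Type) [TopologicalSpace X] [ChartedSpace E3 X] [IsManifold (𝓡 3) ∞ X] [T2Space X]
    [SecondCountableTopology X] [ConnectedSpace X],
    ∀ D ∈ admissibleVacuumData X, IsThroatShielded D →
      ∀ 𝒟 : VacuumCauchyDevelopment D, 𝒟.IsMaximal →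
        Summit.FinalStateConjecture.HasCompleteNullInfinity 𝒟.toCauchyDevelopment ∧ QEsc 𝒟

/-! ## Registered stubs

The `stub_*` theorems below are the registered obligations (sorried). `Registered.stub_*` are the
name-keyed `abbrev` aliases of their statements, taken as the hypotheses of `TameCensorship_of`
(the skeleton audit admits a hypothesis whose head's last name component is a declared stub —
same device as `Summits/ABC/ABC/Cruxes/MazurKaneLaw/Lines/critical-kloosterman-powerful-moduli.lean`). -/

namespace Registered

/-- Alias of `MGHDExistsOnAdmissible` keyed by the registered stub name. -/
abbrev stub_mghdExists : Prop := MGHDExistsOnAdmissible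
/-- Alias of `HiddenSectorGenericity` keyed by the registered stub name. -/
abbrev stub_hiddenCure : Prop := HiddenSectorGenericity
/-- Alias of `BeltedThroatBurial` keyed by the registered stub name. -/
abbrev stub_beltedBurial : Prop := BeltedThroatBurial
/-- Alias of `NeckValve` keyed by the registered stub name. -/
abbrev stub_neckValve : Prop := NeckValve
/-- Alias of `NeckValve → EscapingSectorsKruskal` keyed by the registered stub name. -/
abbrev stub_escapingKruskal : Prop := NeckValve → EscapingSectorsKruskal

end Registered


/-- STUB (shared with stmt-FinalStateConjecture-9937; known theorem, XL formalisation): MGHD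
existence on admissible data. -/
theorem stub_mghdExists : MGHDExistsOnAdmissible := by
  sorry

/-- STUB (HARDEST — the open kernel, two-sided, curable, boxed form): hidden-sector genericity. -/
theorem stub_hiddenCure : HiddenSectorGenericity := by
  sorry

/-- STUB (engine, XL, pure gluing): belted Einstein–Rosen-throat burial of any compactly cured core. -/
theorem stub_beltedBurial : BeltedThroatBurial := by
  sorry

/-- STUB (the lever, L): the throat is a no-way valve — two-sided sealing. -/
theorem stub_neckValve : NeckValve := by
  sorry

/-- STUB (L): given the valve, complete `𝓘⁺` and the escaping sectors of clauses (i)–(ii) are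
exact-Kruskal bookkeeping for throat-shielded admissible data. -/
theorem stub_escapingKruskal : NeckValve → EscapingSectorsKruskal := by
  sorry

/-! ## Recombination of the two sectors (proved) -/

section Recombine

variable {X : Type} [TopologicalSpace X] [ChartedSpace E3 X] [IsManifold (𝓡 3) ∞ X]
  [ConnectedSpace X] {D : InitialDataSet (𝓡 3) X}

/-- Clause (i) from its escaping and shielded halves (case split on the chart selector). -/
theorem noExtremalRemnant_all (𝒟 : VacuumCauchyDevelopment D) (hE : QEsc 𝒟) (hS : QSh 𝒟) :
    ∀ (Λ : lorentzGroup) (c : E4) (M a : ℝ), Kerr.IsExtremal M a →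
      ¬ ∃ (τ₀ : ℝ) (Ψ : (boostedKerrBackground Λ c M a).domain → 𝒟.carrier),
        𝒟.toSpacetime.IsLateChart (boostedKerrBackground Λ c M a) Set.univ τ₀ Ψ ∧
        ∀ R : ℝ, Tendsto (fun τ ↦ 𝒟.toSpacetime.truncDeviationCk
          (boostedKerrBackground Λ c M a) Ψ 2 R τ) atTop (𝓝 0) := by
  rintro Λ c M a hext ⟨τ₀, Ψ, hlate, hconv⟩
  by_cases hs : IsShieldedChart 𝒟.toCauchyDevelopment Λ c M a Ψ
  · exact hS.1 Λ c M a hext ⟨τ₀, Ψ, hlate, hs, hconv⟩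
  · exact hE.1 Λ c M a hext ⟨τ₀, Ψ, hlate, hs, hconv⟩

/-- Clause (ii) from its escaping and shielded halves (`min r₀`, `max Λ`; no chart restriction is
needed thanks to the scale-downward-closed form of `TameOuterAtScale`). -/
theorem tameOuter_all (𝒟 : VacuumCauchyDevelopment D) (hE : QEsc 𝒟) (hS : QSh 𝒟) :
    ∀ [𝒟.metric.HasLeviCivita],
      let outer : Set 𝒟.carrier :=
        𝒟.metric.causalFuture 𝒟.timeOrientation (Set.range 𝒟.embed) ∩
          {q | ∃ (p : X) (γ : ℝ → 𝒟.carrier) (dom : Set ℝ),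
            𝒟.metric.IsNormalisedNullRayFrom 𝒟.timeOrientation 𝒟.embed 𝒟.normal p γ dom ∧
            ¬ BddAbove dom ∧
            q ∈ 𝒟.metric.chronologicalPast 𝒟.timeOrientation (γ '' (dom ∩ Set.Ici 0))}
      ∃ r₀ : ℝ, 0 < r₀ ∧ ∃ Λ : NNReal, ∀ q ∈ outer,
        let U : TopologicalSpace.Opens E4 := ⟨Metric.ball (0 : E4) r₀, Metric.isOpen_ball⟩
        ∃ Ψ : U → 𝒟.carrier,
          𝒟.toSpacetime.IsLateChart (Minkowski.backgroundOn U) Set.univ (-r₀) Ψ ∧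
          (∃ x : U, (x : E4) = 0 ∧ Ψ x = q) ∧
          supCkENorm (U : Set E4) 3
            (𝒟.toSpacetime.deviationExtend (Minkowski.backgroundOn U) Ψ) ≤ (Λ : ENNReal) ∧
          supCkENorm (U : Set E4) 0
            (𝒟.toSpacetime.deviationExtend (Minkowski.backgroundOn U) Ψ) ≤ 1 / 2 := by
  intro hL
  obtain ⟨r₁, hr₁, h₁⟩ := hE.2
  obtain ⟨r₂, hr₂, h₂⟩ := hS.2
  have hr₀ : 0 < min r₁ r₂ := lt_min hr₁ hr₂
  obtain ⟨Λ₁, hΛ₁⟩ := h₁ (min r₁ r₂) hr₀ (min_le_left _ _)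
  obtain ⟨Λ₂, hΛ₂⟩ := h₂ (min r₁ r₂) hr₀ (min_le_right _ _)
  refine ⟨min r₁ r₂, hr₀, max Λ₁ Λ₂, ?_⟩
  rintro q ⟨hqJ, p, γ, dom, hray, hunb, hqI⟩
  have hc₁ : ((Λ₁ : NNReal) : ENNReal) ≤ ((max Λ₁ Λ₂ : NNReal) : ENNReal) :=
    ENNReal.coe_le_coe.2 (le_max_left _ _)
  have hc₂ : ((Λ₂ : NNReal) : ENNReal) ≤ ((max Λ₁ Λ₂ : NNReal) : ENNReal) :=
    ENNReal.coe_le_coe.2 (le_max_right _ _)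
  by_cases hs : IsShieldedRay 𝒟.toCauchyDevelopment γ dom
  · obtain ⟨Ψ, hΨ, hx, h3, h0⟩ := hΛ₂ q ⟨hqJ, p, γ, dom, hray, hunb, hs, hqI⟩
    exact ⟨Ψ, hΨ, hx, h3.trans hc₂, h0⟩
  · obtain ⟨Ψ, hΨ, hx, h3, h0⟩ := hΛ₁ q ⟨hqJ, p, γ, dom, hray, hunb, hs, hqI⟩
    exact ⟨Ψ, hΨ, hx, h3.trans hc₁, h0⟩

end Recombine

/-! ## The composition: the five stubs conclude the crux by name -/

/-- **`TameCensorship` from the five stubs** (real proof, no `sorry`): for each `Σ`, local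
families suffice for curve-genericity (`isChristodoulouGeneric_one_of_local`); through an
admissible exceptional datum `d` take the compactly supported cure of `stub_hiddenCure` and the
belted throat-burial family of `stub_beltedBurial` built on it; a member `F c`, `c ≠ 0`, has an
MGHD (`stub_mghdExists`), and every MGHD has complete `𝓘⁺` and the ESCAPING sectors of clauses
(i)–(ii) (`stub_escapingKruskal ∘ stub_neckValve`, since belted completions are throat-shielded)
and the SHIELDED sectors (`stub_hiddenCure`, since the member is a belted completion of a cured
core), which recombine to the crux's property verbatim. -/
theorem TameCensorship_of :
    Registered.stub_mghdExists → Registered.stub_hiddenCure → Registered.stub_beltedBurial →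
      Registered.stub_neckValve → Registered.stub_escapingKruskal →
      Summit.FinalStateConjecture.FinalStateConjecture.Theses.PhotonSphereChannels.TameCensorship := by
  intro hM hHid hBur hValve hEsc X _ _ _ _ _ _
  have hKr := hEsc hValve
  refine Summit.FinalStateConjecture.FinalStateConjecture.Theorems.PhotonSphereChannels.isChristodoulouGeneric_one_of_local
    fun d hd _ ↦ ?_
  obtain ⟨ε, K, G, hcure, hker⟩ := hHid X d hd
  obtain ⟨ε', F, hε', hF, h0, hinj, hadm, hgood⟩ := hBur X d hd ε K G hcure
  refine ⟨ε', F, hε', hF, h0, hinj, hadm, fun c hc hcε ↦ ?_⟩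
  obtain ⟨s, hs, hsε, K', hK', hKK', hbelt⟩ := hgood c hc hcε
  have hthroat : IsThroatShielded (F c) := by
    obtain ⟨U, -, -, -, M, ρ₂, φ, hφ, -⟩ := hbelt
    exact ⟨M, ρ₂, φ, hφ⟩
  refine ⟨hM X (F c) (hadm c hcε), fun 𝒟 hmax ↦ ?_⟩
  obtain ⟨hcomp, hesc⟩ := hKr X (F c) (hadm c hcε) hthroat 𝒟 hmax
  have hsh : QSh 𝒟 := hker s hs hsε K' hK' hKK' (F c) (hadm c hcε) hbelt 𝒟 hmax
  exact ⟨hcomp, noExtremalRemnant_all 𝒟 hesc hsh, fun {_} ↦ tameOuter_all 𝒟 hesc hsh⟩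

end Summit.FinalStateConjecture.FinalStateConjecture.Cruxes.TameCensorship.NecksAreOneWayValves

end
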